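import Summits.HubbardSuperconductivity.HubbardSuperconductivity.Theorems.LiebTwinTwinOnsiteCondensationTwinPairOrderIdentity
import Summits.HubbardSuperconductivity.HubbardSuperconductivity.Theorems.LiebTwinRectificationRaisesEnergy

/-!
# Route `LiebTwin`, crux `TwinOnsiteCondensation` (stmt-HubbardSuperconductivity-15258), line `birth`:
# on-site rectification monotonicity `F_s(φ) ≤ F_s(φ̃)` (helper, `--supports`)

For every `(n, n)`-sector vector `φ` of the torus whose Lieb matrix `W = liebW n φ` is HERMITIAN (e.g. every
real `φ` with symmetric `W` — Lieb's "W Hermitian WLOG" class), the twin `φ̃ = liebVec n |W|` carries at least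
as much on-site `s`-wave pair order as `φ` itself:
`Re⟨φ, Δ_sᴴ Δ_s φ⟩ ≤ Re⟨φ̃, Δ_sᴴ Δ_s φ̃⟩` (`re_expect_pairField_sWave_le_twin`).
Proof: by the Lieb transfer of the pair field (`expect_pairField_sWave_eq`, tree)
`⟨χ, Δ_sᴴ Δ_s χ⟩ = 2 Σ_{x,y} Tr(Xᴴ B_{yx} X B_{yx}ᵀ)` with `X` the Lieb matrix of `χ` and `B_{yx} = configHop n y x`
(`B_{yx}ᵀ = B_{yx}ᴴ = B_{xy}`); in an eigenbasis of `W` (`W = V D_w Vᴴ`, `|W| = V D_{|w|} Vᴴ`) each term is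
`Tr(W B W Bᴴ) = Σ_{i,j} w_i w_j |(VᴴBV)_{ij}|² ≤ Σ_{i,j} |w_i||w_j| |(VᴴBV)_{ij}|² = Tr(|W| B |W| Bᴴ)` — Lieb's trace
inequality (tree `re_trace_unitConj_mul_le`, here for a non-Hermitian `B`, `re_trace_unitConj_mul_conjTranspose_le`);
`CFC.abs W = V D_{|w|} Vᴴ` is Mathlib's Hermitian functional calculus (tree `cfcAbs_eq_unitConj`,
`eq_unitConj_eigenvalues`, `isHermitian_liebW_of_real` of `LiebTwinRectificationRaisesEnergy`, REUSED).
This is the inequality half of identity (I3) of the route card and the content of the route's support item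
`OnsiteRectificationMonotone` (which assumes `φ` real with symmetric `W`, a special case of Hermitian `W`).
Sources: E. H. Lieb, PRL **62** (1989) 1201, proof of Thm 1 (the inequality after eq. (4)); C. N. Yang, Rev.
Mod. Phys. **34** (1962) 694, §4. No definition and no named fact is introduced.
-/

-- the mandated namespace `Summit.<Summit>.<Problem>.Theorems` repeats `HubbardSuperconductivity`
-- (single-problem summit, D-0017), which the `dupNamespace` linter flags on every declaration
set_option linter.dupNamespace false

noncomputable section

namespace Summit.HubbardSuperconductivity.HubbardSuperconductivity.Theorems.LiebTwinTwin

open Matrix Finset Literature.MathematicalPhysics.QuantumLattice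
open scoped ComplexOrder MatrixOrder Matrix.Norms.L2Operator

/-! ### Lieb's trace inequality for a non-Hermitian middle factor -/

section Spectral

variable {A : Type*} [Fintype A] [DecidableEq A]

/-- **Lieb's trace inequality, two-sided form**: for any square `M`,
`Re Tr(W M W Mᴴ) = Σ_{i,j} w_i w_j |N_{ij}|² ≤ Σ_{i,j} |w_i||w_j| |N_{ij}|² = Re Tr(|W| M |W| Mᴴ)`, `N = Vᴴ M V`,
where `W = V D_w Vᴴ` (`unitConj V w`) and `|W| = V D_{|w|} Vᴴ` (no Hermiticity of `M` is needed because the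
fourth factor is `Mᴴ`). Lieb, PRL 62 (1989) 1201, proof of Theorem 1 (inequality after eq. (4)). [folklore] -/
theorem re_trace_unitConj_mul_conjTranspose_le (V : Matrix A A ℂ) (f : A → ℝ) (M : Matrix A A ℂ) :
    ((unitConj V f * M * unitConj V f * Mᴴ).trace).re ≤
      ((unitConj V |f| * M * unitConj V |f| * Mᴴ).trace).re := by
  set N := Vᴴ * M * V with hN
  have hNh : Vᴴ * Mᴴ * V = Nᴴ := by
    rw [hN, conjTranspose_mul, conjTranspose_mul, conjTranspose_conjTranspose, Matrix.mul_assoc]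
  have key : ∀ g : A → ℝ, ((unitConj V g * M * unitConj V g * Mᴴ).trace).re =
      ∑ a, ∑ b, g a * g b * ‖N a b‖ ^ 2 := by
    intro g
    rw [trace_unitConj_mul_mul, ← hN, hNh, trace_diagonal_mul_mul_diagonal_mul, Complex.re_sum]
    refine Finset.sum_congr rfl fun a _ => ?_
    rw [Complex.re_sum]
    refine Finset.sum_congr rfl fun b _ => ?_
    rw [conjTranspose_apply, Complex.star_def, show (g a : ℂ) * N a b * (g b : ℂ) * (starRingEnd ℂ) (N a b)
      = (g a : ℂ) * (g b : ℂ) * (N a b * (starRingEnd ℂ) (N a b)) by ring, Complex.mul_conj']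
    norm_cast
  rw [key, key]
  refine Finset.sum_le_sum fun a _ => Finset.sum_le_sum fun b _ => ?_
  refine mul_le_mul_of_nonneg_right ?_ (sq_nonneg _)
  rw [Pi.abs_apply, Pi.abs_apply, ← abs_mul]
  exact le_abs_self _

end Spectral

/-! ### Rectification monotonicity on the torus -/

section Torus

variable {L : ℕ} [NeZero L]

/-- **Rectification never lowers the on-site pair order (Hermitian Lieb matrices).** For a Hermitian `W`
on `n`-subsets of the torus: `Re⟨liebVec n W, Δ_sᴴ Δ_s liebVec n W⟩ ≤ Re⟨liebVec n |W|, Δ_sᴴ Δ_s liebVec n |W|⟩`,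
`|W| = CFC.abs W` — termwise Lieb's trace inequality `Re Tr(W B W Bᴴ) ≤ Re Tr(|W| B |W| Bᴴ)`, `B = configHop n y x`.
Lieb, PRL 62 (1989) 1201, proof of Theorem 1; Yang, Rev. Mod. Phys. 34 (1962) 694, §4. [folklore] -/
theorem re_expect_pairField_sWave_liebVec_le_abs (n : ℕ)
    {W : Matrix (Config (FermionTorus 2 L) n) (Config (FermionTorus 2 L) n) ℂ} (hW : W.IsHermitian) :
    (expect ((pairField sWave L)ᴴ * pairField sWave L) (liebVec n W)).re ≤
      (expect ((pairField sWave L)ᴴ * pairField sWave L) (liebVec n (CFC.abs W))).re := by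
  have hsa : (CFC.abs W)ᴴ = CFC.abs W := (CFC.abs_nonneg W).isSelfAdjoint.star_eq
  have h2 : (2 : ℂ) = ((2 : ℝ) : ℂ) := by norm_num
  rw [expect_pairField_sWave_eq (isInSector_liebVec n W), LiebThm1.liebW_liebVec,
    expect_pairField_sWave_eq (isInSector_liebVec n (CFC.abs W)), LiebThm1.liebW_liebVec,
    h2, Complex.re_ofReal_mul, Complex.re_ofReal_mul, Complex.re_sum, Complex.re_sum]
  refine mul_le_mul_of_nonneg_left (Finset.sum_le_sum fun x _ => ?_) (by norm_num)
  rw [Complex.re_sum, Complex.re_sum]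
  refine Finset.sum_le_sum fun y _ => ?_
  have hWh : Wᴴ = W := hW
  rw [hWh, hsa, configHop_transpose, ← configHop_conjTranspose n y x]
  have h := re_trace_unitConj_mul_conjTranspose_le (hW.eigenvectorUnitary : Matrix _ _ ℂ) hW.eigenvalues
    (configHop n y x)
  rw [← eq_unitConj_eigenvalues hW, ← cfcAbs_eq_unitConj hW] at h
  simpa only [Matrix.mul_assoc] using h

/-- **On-site rectification monotonicity for sector vectors.** For every `(n, n)`-sector vector `φ` of the
torus with Hermitian Lieb matrix (`(liebW n φ)ᴴ = liebW n φ`; e.g. `φ` real with `(liebW n φ)ᵀ = liebW n φ`),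
the twin `φ̃ = liebVec n (CFC.abs (liebW n φ))` has `F_s(φ) ≤ F_s(φ̃)`,
`F_s(χ) = Re⟨χ, (pairField sWave L)ᴴ (pairField sWave L) χ⟩`: on-site pair order can only grow under
rectification (inequality half of identity (I3) of the route card). Lieb, PRL 62 (1989) 1201, proof of
Theorem 1; Yang, Rev. Mod. Phys. 34 (1962) 694, §4. [folklore] -/
theorem re_expect_pairField_sWave_le_twin :
    ∀ (L : ℕ) [NeZero L] (n : ℕ) (φ : Fock (Orb (FermionTorus 2 L))), IsInSector n n φ →
      (liebW n φ)ᴴ = liebW n φ →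
        (expect ((pairField sWave L)ᴴ * pairField sWave L) φ).re ≤
          (expect ((pairField sWave L)ᴴ * pairField sWave L) (liebVec n (CFC.abs (liebW n φ)))).re := by
  intro L _ n φ hφ hW
  have h := re_expect_pairField_sWave_liebVec_le_abs (L := L) n (W := liebW n φ) hW
  rwa [LiebThm1.liebVec_liebW hφ] at h

/-- **On-site rectification monotonicity, real form** — exactly the shape of the route's support statement
`OnsiteRectificationMonotone`: for every real `(n, n)`-sector `φ` with symmetric Lieb matrix,
`F_s(φ) ≤ F_s(φ̃)`. Lieb, PRL 62 (1989) 1201, proof of Theorem 1. [folklore] -/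
theorem re_expect_pairField_sWave_le_twin_of_real :
    ∀ (L : ℕ) [NeZero L] (n : ℕ) (φ : Fock (Orb (FermionTorus 2 L))), (∀ s, star (φ s) = φ s) →
      IsInSector n n φ → (liebW n φ)ᵀ = liebW n φ →
        (expect ((pairField sWave L)ᴴ * pairField sWave L) φ).re ≤
          (expect ((pairField sWave L)ᴴ * pairField sWave L) (liebVec n (CFC.abs (liebW n φ)))).re :=
  fun L _ n φ hreal hφ hsymm =>
    re_expect_pairField_sWave_le_twin L n φ hφ (isHermitian_liebW_of_real hreal hsymm)

end Torus

end Summit.HubbardSuperconductivity.HubbardSuperconductivity.Theorems.LiebTwinTwin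

end
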